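import Summits.QuantumAdvantage.QuantumAdvantage.Theorems.LinnikCubicClassGroupsDegreeOnePrimesEscapeRayClassShortIntervalDegOne
import Summits.QuantumAdvantage.QuantumAdvantage.Theorems.LinnikCubicClassGroupsDegreeOnePrimesEscapeAbelianChebotarevLinnikAll
import HarnessLib

/-!
# Linnik's theorem for cosets of a congruence class group, XVIII: Chebotarev in SHORT INTERVALS for ABELIAN extensions,
# with degree-one primes and an exponent depending only on the base field

Topic `Summits/QuantumAdvantage/QuantumAdvantage/Theorems`, cell B2b-1 (linnik-cubic), PART A (gen 25); helper toward
the crux `DegreeOnePrimesEscape` (stmt-QuantumAdvantage-11543) of route `LinnikCubicClassGroups`.  HONEST FRAMING: the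
value of this file is a THEOREM (kernel-checked, GRH-free, Siegel-free) — NOT summit progress (the route still rests on
the hypothesis-type target `PureCubicClassNumberHard`).

Let `N/K` be a finite Galois extension of number fields with COMMUTATIVE group, `[K:ℚ] = n > 1`, and `𝔪 ≠ 0` an ideal
of `𝓞 K` modulo which the Artin symbol of `N/K` is defined (`ArtinKillsRay 𝔪 (χ ∘ galFrob K N)` for every character
`χ`; proved in the tree for every abelian `N/K` with a modulus supported on the ramified primes,
`exists_modulus_artinKillsRay_of_commute`).  The degree-one Hoheisel–Linnik theorem for cosets (file XV) gives:
* `exists_degOnePrime_galFrob_eq_mem_Ioc` — there are `δ = δ(n) > 0`, `L = L(n) > 0` such that **every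
  `σ ∈ Gal(N/K)` is the Frobenius `galFrob K N 𝔭` of a prime `𝔭 ∤ 𝔪` of RESIDUE DEGREE ONE with `x < N𝔭 ≤ x + h`**,
  for every `x ≥ (|d_K| n^n N𝔪)^L` and `x^{1−δ} ≤ h ≤ x` — the exponent depends only on `n`, not on `[N:K]`;
* `exists_degOnePrime_frobenius_eq_mem_Ioc_of_commute` — **the unconditional form for every finite abelian `N/K`**:
  a modulus `𝔪 ≠ 0` dividing exactly the ramified primes exists, and then every `σ` is the common value of ALL Frobenii
  at an unramified degree-one prime `𝔭 ∤ 𝔪` with `x < N𝔭 ≤ x + h` as above.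
The gen-23 files (`exists_degOnePrime_galFrob_eq`, `exists_degOnePrime_frobenius_eq_of_commute`) gave the least such
prime `≤ Q_𝔪^L`; in print Chebotarev in short intervals is Balog–Ono 2001 (fixed field) and the K-uniform least prime
is Weiss 1983 §6 / Thorner–Zaman 2017 Thm 3.1 — ours is kernel-checked with inexplicit `δ(n), L(n)`.
References: [Weiss1983] §6; [ThornerZaman2017] Thm 3.1; [LagariasMontgomeryOdlyzko1979] §7; [Childress2009] Ch. 5 Thm 2.1.
-/

noncomputable section

open Complex Real Set Filter Topology NumberField IsDedekindDomain
open scoped NumberField nonZeroDivisors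

namespace Summit.QuantumAdvantage.QuantumAdvantage.Theorems.DegreeOnePrimesEscape

open Literature.NumberTheory.LFunctions Literature.NumberTheory.LFunctions.NumberField
  Literature.NumberTheory.LFunctions.AbelianDensity Literature.NumberTheory.GaloisRepresentations
open scoped Classical

/-- **Chebotarev in short intervals for abelian extensions, degree-one primes, base-field exponent** (see the module
docstring): for `n > 1` there are `δ, L > 0` such that for every number field `K` of degree `n`, every finite Galois
`N/K` with commutative group, every `𝔪 ≠ 0` modulo which the Artin symbol of `N/K` is defined, every
`x ≥ (|d_K| n^n N𝔪)^L`, every `x^{1−δ} ≤ h ≤ x` and every `σ ∈ Gal(N/K)` there is a prime `𝔭 ∤ 𝔪` of `K` with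
`galFrob K N 𝔭 = σ`, `N𝔭` a rational prime and `x < N𝔭 ≤ x + h`. [cite: Weiss1983, §6] [cite: ThornerZaman2017, Theorem 3.1]
[cite: LagariasMontgomeryOdlyzko1979, §7] -/
theorem exists_degOnePrime_galFrob_eq_mem_Ioc (n : ℕ) (hn : 1 < n) :
    ∃ δ L : ℝ, 0 < δ ∧ 0 < L ∧ ∀ (K : Type) [Field K] [NumberField K], Module.finrank ℚ K = n →
    ∀ (N : Type) [Field N] [NumberField N] [Algebra K N] [IsGalois K N],
      (∀ a b : N ≃ₐ[K] N, Commute a b) →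
    ∀ (𝔪 : Ideal (𝓞 K)), 𝔪 ≠ ⊥ →
      (∀ χ : (N ≃ₐ[K] N) →* ℂˣ, ArtinKillsRay 𝔪 (fun v ↦ χ (galFrob K N v))) →
      ∀ x h : ℝ, rayCondQ K 𝔪 ^ L ≤ x → x ^ (1 - δ) ≤ h → h ≤ x →
      ∀ σ : N ≃ₐ[K] N, ∃ v : HeightOneSpectrum (𝓞 K), ¬ 𝔪 ≤ v.asIdeal ∧ galFrob K N v = σ ∧
        (Ideal.absNorm v.asIdeal).Prime ∧ x < (Ideal.absNorm v.asIdeal : ℝ) ∧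
        (Ideal.absNorm v.asIdeal : ℝ) ≤ x + h := by
  obtain ⟨δ, L, hδ, hL, hF⟩ := exists_degOnePrime_fiber_absNorm_mem_Ioc n hn
  refine ⟨δ, L, hδ, hL, fun K _ _ hKn N _ _ _ _ hcomm 𝔪 h𝔪 hray x h hx hhx hhx' σ ↦ ?_⟩
  haveI : FiniteDimensional K N := Module.Finite.of_restrictScalars_finite ℚ K N
  letI : CommGroup (N ≃ₐ[K] N) :=
    { (inferInstance : Group (N ≃ₐ[K] N)) with mul_comm := fun a b ↦ (hcomm a b).eq }
  have hK : 1 < Module.finrank ℚ K := by rw [hKn]; exact hn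
  -- (1) the Frobenius datum kills the narrow ray `mod 𝔪` (characters separate points)
  have hrayG : ArtinKillsRay 𝔪 (galFrob K N) := by
    intro b c hb hc hcop hbc hpos
    have hb' : (Ideal.span {b} : Ideal (𝓞 K)) ≠ ⊥ := by simpa [Ideal.span_singleton_eq_bot] using hb
    have hc' : (Ideal.span {c} : Ideal (𝓞 K)) ≠ ⊥ := by simpa [Ideal.span_singleton_eq_bot] using hc
    by_contra hne
    have hne' : artinSymbol (galFrob K N) (Ideal.span {b}) *
        (artinSymbol (galFrob K N) (Ideal.span {c}))⁻¹ ≠ 1 := by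
      rwa [Ne, mul_inv_eq_one]
    haveI : NeZero ((Monoid.exponent (N ≃ₐ[K] N) : ℕ) : ℂ) :=
      ⟨Nat.cast_ne_zero.mpr Monoid.exponent_ne_zero_of_finite⟩
    obtain ⟨χ, hχ⟩ := CommGroup.exists_apply_ne_one_of_hasEnoughRootsOfUnity (N ≃ₐ[K] N) ℂ hne'
    apply hχ
    have e := hray χ b c hb hc hcop hbc hpos
    rw [map_mul, map_inv, map_artinSymbol χ _ hb', map_artinSymbol χ _ hc', Function.comp_def, e,
      mul_inv_cancel]
  -- (2) non-trivial characters are non-principal off `𝔪` (the Frobenii off a finite set generate)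
  have hsep : ∀ ψ : AddChar (Additive (N ≃ₐ[K] N)) ℂ, ψ ≠ 0 →
      ∃ v : HeightOneSpectrum (𝓞 K), ¬ 𝔪 ≤ v.asIdeal ∧ ψ (Additive.ofMul (galFrob K N v)) ≠ 1 := by
    intro ψ hψ
    by_contra hall
    push Not at hall
    apply hψ
    set B : Set (HeightOneSpectrum (𝓞 K)) :=
      {v | 𝔪 ≤ v.asIdeal} ∪ {v | ¬ Algebra.IsUnramifiedIn (𝓞 N) v.asIdeal} with hB
    have hBfin : B.Finite := by
      refine Set.Finite.union ?_ (finite_setOf_not_isUnramifiedIn K N)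
      refine (Ideal.finite_factors h𝔪).subset fun v hv ↦ ?_
      exact Ideal.dvd_iff_le.mpr hv
    have hgen := closure_frobenius_eq_top hcomm hBfin
    have hker : ∀ τ : N ≃ₐ[K] N, ψ (Additive.ofMul τ) = 1 := by
      intro τ
      have hτ : τ ∈ Subgroup.closure {φ : N ≃ₐ[K] N | ∃ v : HeightOneSpectrum (𝓞 K), v ∉ B ∧
          ∃ Q ∈ v.asIdeal.primesOver (𝓞 N), IsArithFrobAt (𝓞 K) φ Q} := by
        rw [hgen]; exact Subgroup.mem_top τ
      induction hτ using Subgroup.closure_induction with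
      | mem φ hφ =>
        obtain ⟨v, hvB, Q, hQ, hφQ⟩ := hφ
        simp only [hB, Set.mem_union, Set.mem_setOf_eq, not_or, not_not] at hvB
        rw [eq_galFrob hcomm hvB.2 hQ hφQ]
        exact hall v hvB.1
      | one => rw [ofMul_one, AddChar.map_zero_eq_one]
      | mul φ φ' _ _ h1 h2 => rw [ofMul_mul, AddChar.map_add_eq_mul, h1, h2, one_mul]
      | inv φ _ h1 => rw [ofMul_inv, AddChar.map_neg_eq_inv, h1, inv_one]
    exact DFunLike.ext ψ 0 fun a ↦ by rw [AddChar.zero_apply]; exact hker (Additive.toMul a)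
  -- (3) `|Gal(N/K)| ≤ |Cl_K^𝔪| ≤ Q_𝔪⁴` (the Artin map on the ray class group is onto)
  haveI : Finite (RayClassGroup 𝔪) := finite_rayClassGroup h𝔪
  have hsurj : Function.Surjective (rayClassArtinHom h𝔪 hrayG) := by
    intro τ
    obtain ⟨𝔅, h𝔅, e⟩ := exists_mem_idealsPrimeTo_artinHom_eq hcomm (MonoidHom.id (N ≃ₐ[K] N)) h𝔪 τ
    refine ⟨QuotientGroup.mk ⟨𝔅, h𝔅⟩, ?_⟩
    rw [rayClassArtinHom_mk]
    simpa only [MonoidHom.id_apply] using e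
  have hG : (Nat.card (N ≃ₐ[K] N) : ℝ) ≤ rayCondQ K 𝔪 ^ (4 : ℕ) :=
    le_trans (by exact_mod_cast Nat.card_le_card_of_surjective _ hsurj)
      (natCard_rayClassGroup_le_rayCondQ_pow hK h𝔪)
  -- (4) the degree-one window theorem for cosets
  exact hF K hKn (N ≃ₐ[K] N) 𝔪 (galFrob K N) h𝔪 hrayG hsep hG x h hx hhx hhx' σ

/-- **Chebotarev in short intervals for every finite ABELIAN extension of number fields, unconditionally**: for `n > 1`
there are `δ, L > 0` such that for every number field `K` of degree `n` and every finite Galois `N/K` with commutative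
group there is a modulus `𝔪 ≠ 0` dividing exactly the primes ramified in `N` such that, for every `x ≥ (|d_K| n^n N𝔪)^L`,
every `x^{1−δ} ≤ h ≤ x` and every `σ ∈ Gal(N/K)`, there is a prime `𝔭 ∤ 𝔪` of `K`, unramified in `N`, whose norm is
a rational prime `p` with `x < p ≤ x + h`, all of whose Frobenii equal `σ`. [cite: Weiss1983, §6]
[cite: Childress2009, Ch. 5 §2 Thm. 2.1] [cite: LagariasMontgomeryOdlyzko1979, §7] -/
theorem exists_degOnePrime_frobenius_eq_mem_Ioc_of_commute (n : ℕ) (hn : 1 < n) :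
    ∃ δ L : ℝ, 0 < δ ∧ 0 < L ∧ ∀ (K : Type) [Field K] [NumberField K], Module.finrank ℚ K = n →
    ∀ (N : Type) [Field N] [NumberField N] [Algebra K N] [IsGalois K N],
      (∀ a b : N ≃ₐ[K] N, Commute a b) →
      ∃ 𝔪 : Ideal (𝓞 K), 𝔪 ≠ ⊥ ∧
        (∀ v : HeightOneSpectrum (𝓞 K), 𝔪 ≤ v.asIdeal ↔ ¬ Algebra.IsUnramifiedIn (𝓞 N) v.asIdeal) ∧
        ∀ x h : ℝ, rayCondQ K 𝔪 ^ L ≤ x → x ^ (1 - δ) ≤ h → h ≤ x →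
        ∀ σ : N ≃ₐ[K] N, ∃ v : HeightOneSpectrum (𝓞 K), ¬ 𝔪 ≤ v.asIdeal ∧
          Algebra.IsUnramifiedIn (𝓞 N) v.asIdeal ∧
          (Ideal.absNorm v.asIdeal).Prime ∧ x < (Ideal.absNorm v.asIdeal : ℝ) ∧
          (Ideal.absNorm v.asIdeal : ℝ) ≤ x + h ∧
          ∀ Q ∈ v.asIdeal.primesOver (𝓞 N), ∀ φ : N ≃ₐ[K] N, IsArithFrobAt (𝓞 K) φ Q → φ = σ := by
  obtain ⟨δ, L, hδ, hL, h⟩ := exists_degOnePrime_galFrob_eq_mem_Ioc n hn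
  refine ⟨δ, L, hδ, hL, fun K _ _ hKn N _ _ _ _ hcomm ↦ ?_⟩
  obtain ⟨𝔪, h𝔪, hiff, hray⟩ := exists_modulus_artinKillsRay_of_commute K N hcomm
  refine ⟨𝔪, h𝔪, hiff, fun x h' hx hhx hhx' σ ↦ ?_⟩
  obtain ⟨v, hm, hF, hpr, hlo, hhi⟩ := h K hKn N hcomm 𝔪 h𝔪 hray x h' hx hhx hhx' σ
  have hunr : Algebra.IsUnramifiedIn (𝓞 N) v.asIdeal := by
    by_contra hr; exact hm ((hiff v).2 hr)
  exact ⟨v, hm, hunr, hpr, hlo, hhi, fun Q hQ φ hφ ↦ (eq_galFrob hcomm hunr hQ hφ).trans hF⟩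

end Summit.QuantumAdvantage.QuantumAdvantage.Theorems.DegreeOnePrimesEscape

end
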